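import Summits.BirchSwinnertonDyer.BirchSwinnertonDyer.Theses.RamifiedSevenEllipticUnits
import HarnessLib

set_option linter.dupNamespace false

/-!
# Route `RamifiedSevenEllipticUnits` (rung K7r) — the ASSEMBLY item, closed

The assembly item `Assembly` of the route file
`Summits/BirchSwinnertonDyer/BirchSwinnertonDyer/Theses/RamifiedSevenEllipticUnits.lean`
(stmt-BirchSwinnertonDyer-19148) is the implication
`EllipticUnitIndexSeven → StrictTorsionSeven → StrictControlSeven → FrameDataSeven →
PublishedFactsSeven → X12.CMRamifiedSeven`. It is literally the deciding theorem `closes` of the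
route, i.e. one application of the Theorems-side bridge
`CMRungInputs.cmRamifiedSeven_of_inputs` (p406906): unpack the frame data at `7` and the published
facts, instantiate the three O11 cruxes at `W ∈ 𝒞₇`, apply
`X12.ClassCSeven.forall_bsdp_of_O11_halves` (p397188). Pure logic; nothing new is asserted; the three
cruxes, the frame data and the published facts remain the route's open items.
-/

namespace Summit.BirchSwinnertonDyer.BirchSwinnertonDyer.Theorems

/-- **Assembly of route K7r `RamifiedSevenEllipticUnits` (stmt-BirchSwinnertonDyer-19148).** The three
O11 cruxes at `p = 7` on 𝒞₇ ((R-EU) `EllipticUnitIndexSeven`, (R-tors) `StrictTorsionSeven`, (R-ctrl)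
`StrictControlSeven`), the frame data `FrameDataSeven` and the published facts `PublishedFactsSeven`
give the rung leaf `X12.CMRamifiedSeven` (`BSD(E, p)` for every `E ∈ 𝒞₇` and every prime `p`): one
application of the bridge `CMRungInputs.cmRamifiedSeven_of_inputs`. -/
theorem ramifiedSevenEllipticUnits_assembly_proof :
    Summit.BirchSwinnertonDyer.BirchSwinnertonDyer.Theses.RamifiedSevenEllipticUnits.Assembly := by
  intro h₁ h₂ h₃ h₄ h₅
  exact Summit.BirchSwinnertonDyer.BirchSwinnertonDyer.Rank1Residual.CMRungInputs.cmRamifiedSeven_of_inputs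
    h₁ h₂ h₃ h₄ h₅

end Summit.BirchSwinnertonDyer.BirchSwinnertonDyer.Theorems
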